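import Literature.MathematicalPhysics.StatisticalMechanics.SpecificRelativeEntropyProofs
import Mathlib.Probability.ProductMeasure
import HarnessLib

/-!
# Route `MourreKoopmanCharges`, crux `LinearToEntropyInBand` (stmt-AtomisticToContinuum-17740), skeleton v7,
# stub 4a-i `stub_visibleOneBlockEstimateInBand`: ball marginals — the PRODUCT-REFERENCE core of
# `ballMarginal_klDiv_sum_le` (superadditivity of relative entropy over independent coordinate blocks)

Support file (`--supports stmt-AtomisticToContinuum-17740`; registered toolkit stub
`stub_ballMarginalsProductCore`) of the line `registered` (`Cruxes/LinearToEntropyInBand/Lines/birth.lean`),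
serving its stub 4a-i `VisibleFluxGibbsianity → VisibleOneBlockEstimateInBand` — THE ball-wise localisation
of the architecture audit `Cruxes/LinearToEntropyInBand/AUDIT-4a.md` § 3.  Item 2 there,
`ballMarginal_klDiv_sum_le` : `Σ_B KL(f|_{B⁺} ‖ ψ|_{B⁺}) ≤ C_ov · KL(f ‖ ψ) + o(N)` over an `r`-grid of enlarged balls
of overlap multiplicity `C_ov`, rests — once the labelled-torus → block-restriction bridge and the hard-core /
canonical corrections to a product reference are in place (not here) — on ONE measure-theoretic fact:
RELATIVE ENTROPY IS SUPERADDITIVE OVER DISJOINT BLOCKS OF INDEPENDENT COORDINATES.  This file proves that fact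
in Mathlib's vocabulary, for a probability measure `μ` on a product `Π i, X i` (ANY measurable spaces, ANY index
type `ι`) against the product `Measure.infinitePi ν` of probability measures `ν i`:

* § 1 `infinitePi_map_piEquivPiSubtypeProd`: splitting the coordinates along a predicate `p` maps
  `infinitePi ν` to the PRODUCT of the two sub-products (independence of disjoint coordinate blocks; uniqueness
  `Measure.eq_infinitePi` on finite boxes);
* § 2 `klDiv_map_restrict_add_klDiv_map_restrict_compl_le`:
  `KL(μ|_p ‖ ⊗_{p} ν) + KL(μ|_{¬p} ‖ ⊗_{¬p} ν) ≤ KL(μ ‖ ⊗ ν)` — the tree's binary superadditivity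
  `Literature.MathematicalPhysics.StatisticalMechanics.klDiv_map_fst_add_klDiv_map_snd_le`
  (`KL(ρ₁ ‖ α) + KL(ρ₂ ‖ β) ≤ KL(ρ ‖ α ⊗ β)`, proved there by densities, no disintegration) transported along
  `MeasurableEquiv.piEquivPiSubtypeProd` (`klDiv_map_eq_of_leftInverse`); whence the coordinate-block
  data-processing inequality `klDiv_map_restrict_le_klDiv_infinitePi` (`KL(μ|_S ‖ ⊗_S ν) ≤ KL(μ ‖ ⊗ ν)`, no
  standard-Borel hypothesis) and, re-indexing along `MeasurableEquiv.piCongrLeft`, binary superadditivity over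
  DISJOINT BLOCKS `klDiv_map_restrict_add_klDiv_map_restrict_le_union`
  (`KL(μ|_S ‖ ·) + KL(μ|_T ‖ ·) ≤ KL(μ|_{S ∪ T} ‖ ·)`, `S ∩ T = ∅`);
* § 3 finite families: `sum_klDiv_map_restrict_le_biUnion` / `sum_klDiv_map_restrict_le_klDiv_infinitePi`
  (`Σ_b KL(μ|_{S_b} ‖ ⊗_{S_b} ν) ≤ KL(μ|_{⋃ S_b} ‖ ·) ≤ KL(μ ‖ ⊗ ν)` for pairwise disjoint blocks) and the OVERLAP form
  the ball cover needs, `sum_klDiv_map_restrict_le_mul_klDiv_infinitePi`: if the blocks carry a colouring by `Fin C`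
  under which equal colours are disjoint (an `r`-grid of balls of radius `(1 + 1/10) r` in `𝕋³` is so coloured by
  residues, `C = C_ov`), then `Σ_b KL(μ|_{S_b} ‖ ⊗_{S_b} ν) ≤ C · KL(μ ‖ ⊗ ν)`;
* § 4 single coordinates: `sum_klDiv_map_eval_le_klDiv_pi` (`Σ_i KL(μ_i ‖ ν_i) ≤ KL(μ ‖ Measure.pi ν)`, `ι` finite;
  induction along `MeasurableEquiv.piFinSuccAbove`, re-indexing along `piCongrLeft`), its `infinitePi` forms
  `sum_klDiv_map_eval_le_klDiv_infinitePi`, `finsetSum_klDiv_map_eval_le_klDiv_infinitePi`;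
* § 5 the registered stub `stub_ballMarginalsProductCore` (conjunction of § 4, § 2-union, § 3).

All `⊤` cases are automatic (`klDiv` is `ℝ≥0∞`-valued).  Nothing here restates the crux, a stub or the Statement;
no definition is introduced.  NOT here (AUDIT-4a § 3 items 1, 3, 4, rest of item 2): ball restrictions of labelled
torus configurations, the splice law, hard-core / canonical corrections, frozen-reference mismatch, window locality.
References (folklore): Georgii, *Gibbs Measures and Phase Transitions* (2011) § 15.1; Cover–Thomas (2006) Thm 2.5.3,
§ 2.6; Kipnis–Landim (1999) App. 1.8; Yau, Lett. Math. Phys. 22 (1991) § 2 (ball-wise use).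
-/

noncomputable section

open MeasureTheory Set InformationTheory
open scoped ENNReal BigOperators

universe u

namespace Summit.AtomisticToContinuum.HydrodynamicLimit.Theorems.LTEInBand

open Literature.MathematicalPhysics.StatisticalMechanics (klDiv_map_eq_of_leftInverse
  klDiv_map_fst_add_klDiv_map_snd_le)

/-! ### § 1 Product structure of `infinitePi` along a splitting of the coordinates -/

section Blocks

variable {ι : Type*} {X : ι → Type*} [∀ i, MeasurableSpace (X i)]

/-- **Disjoint coordinate blocks are independent under a product measure.**  Splitting the coordinates of
`Π i, X i` into those satisfying `p` and the others (`MeasurableEquiv.piEquivPiSubtypeProd`) maps the product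
probability `⊗ᵢ νᵢ = Measure.infinitePi ν` to the PRODUCT `(⊗_{p i} νᵢ) ⊗ (⊗_{¬ p i} νᵢ)` of the two sub-products
(checked on finite boxes via the uniqueness `Measure.eq_infinitePi`). [folklore] -/
theorem infinitePi_map_piEquivPiSubtypeProd (ν : Π i, Measure (X i))
    [∀ i, IsProbabilityMeasure (ν i)] (p : ι → Prop) [DecidablePred p] :
    (Measure.infinitePi ν).map (MeasurableEquiv.piEquivPiSubtypeProd X p) =
      (Measure.infinitePi fun i : Subtype p => ν i).prod
        (Measure.infinitePi fun i : {i // ¬ p i} => ν i) := by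
  set e := MeasurableEquiv.piEquivPiSubtypeProd X p with he
  have key : ((Measure.infinitePi fun i : Subtype p => ν i).prod
      (Measure.infinitePi fun i : {i // ¬ p i} => ν i)).map e.symm = Measure.infinitePi ν := by
    refine Measure.eq_infinitePi ν fun s t ht => ?_
    classical
    rw [MeasurableEquiv.map_apply, ← Set.univ_pi_ite]
    have hpre : e.symm ⁻¹' (Set.univ.pi fun i => if i ∈ (s : Set ι) then t i else Set.univ) =
        (Equiv.piEquivPiSubtypeProd p X).symm ⁻¹'
          (Set.univ.pi fun i => if i ∈ (s : Set ι) then t i else Set.univ) := rfl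
    rw [hpre, Equiv.preimage_piEquivPiSubtypeProd_symm_pi, Measure.prod_prod]
    have h1 : (Set.univ.pi fun i : Subtype p => if (i : ι) ∈ (s : Set ι) then t i else Set.univ) =
        Set.pi (↑(s.subtype p)) fun i : Subtype p => t i := by
      ext x
      simp [Set.mem_ite_univ_right, Finset.mem_subtype]
    have h2 : (Set.univ.pi fun i : {i // ¬ p i} => if (i : ι) ∈ (s : Set ι) then t i else Set.univ) =
        Set.pi (↑(s.subtype fun i => ¬ p i)) fun i : {i // ¬ p i} => t i := by
      ext x
      simp [Set.mem_ite_univ_right, Finset.mem_subtype]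
    rw [h1, h2, Measure.infinitePi_pi (fun i : Subtype p => ν i) (s := s.subtype p)
        (t := fun i : Subtype p => t i) (fun i _ => ht i),
      Measure.infinitePi_pi (fun i : {i // ¬ p i} => ν i) (s := s.subtype fun i => ¬ p i)
        (t := fun i : {i // ¬ p i} => t i) (fun i _ => ht i),
      Finset.prod_subtype_eq_prod_filter (fun i => ν i (t i)),
      Finset.prod_subtype_eq_prod_filter (fun i => ν i (t i)),
      Finset.prod_filter_mul_prod_filter_not]
  rw [← key, MeasurableEquiv.map_map_symm]

/-! ### § 2 Superadditivity over two complementary / two disjoint blocks -/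

variable (μ : Measure (Π i, X i)) [IsProbabilityMeasure μ] (ν : Π i, Measure (X i))
  [∀ i, IsProbabilityMeasure (ν i)]

/-- **Superadditivity of the relative entropy over complementary coordinate blocks.**  For a probability
`μ` on `Π i, X i` and a product reference `⊗ᵢ νᵢ` of probabilities,
`KL(μ|_{p} ‖ ⊗_{p i} νᵢ) + KL(μ|_{¬p} ‖ ⊗_{¬p i} νᵢ) ≤ KL(μ ‖ ⊗ᵢ νᵢ)` (`μ|_p` the law of the block of coordinates
satisfying `p`): the binary product superadditivity `klDiv_map_fst_add_klDiv_map_snd_le` of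
`Literature.MathematicalPhysics.StatisticalMechanics` transported along `MeasurableEquiv.piEquivPiSubtypeProd`
(§ 1 and invariance of `klDiv` under measurable equivalences).  Georgii, *Gibbs Measures and Phase Transitions*
§ 15.1. [folklore] -/
theorem klDiv_map_restrict_add_klDiv_map_restrict_compl_le (p : ι → Prop) [DecidablePred p] :
    klDiv (μ.map fun x (i : Subtype p) => x i) (Measure.infinitePi fun i : Subtype p => ν i) +
      klDiv (μ.map fun x (i : {i // ¬ p i}) => x i)
        (Measure.infinitePi fun i : {i // ¬ p i} => ν i) ≤
      klDiv μ (Measure.infinitePi ν) := by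
  set e := MeasurableEquiv.piEquivPiSubtypeProd X p with he
  haveI : IsProbabilityMeasure (μ.map e) :=
    Measure.isProbabilityMeasure_map e.measurable.aemeasurable
  have h1 : (μ.map e).map Prod.fst = μ.map fun x (i : Subtype p) => x i := by
    rw [Measure.map_map measurable_fst e.measurable]
    rfl
  have h2 : (μ.map e).map Prod.snd = μ.map fun x (i : {i // ¬ p i}) => x i := by
    rw [Measure.map_map measurable_snd e.measurable]
    rfl
  have h3 : klDiv μ (Measure.infinitePi ν) = klDiv (μ.map e) ((Measure.infinitePi ν).map e) :=
    (klDiv_map_eq_of_leftInverse e.measurable e.symm.measurable e.symm_apply_apply).symm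
  rw [h3, infinitePi_map_piEquivPiSubtypeProd, ← h1, ← h2]
  exact klDiv_map_fst_add_klDiv_map_snd_le _ _ _

/-- **Data processing for coordinate blocks** (no standard-Borel hypothesis): the law of a block of
coordinates has relative entropy w.r.t. the corresponding sub-product at most `KL(μ ‖ ⊗ᵢ νᵢ)`,
`KL(μ|_S ‖ ⊗_{i ∈ S} νᵢ) ≤ KL(μ ‖ ⊗ᵢ νᵢ)` (drop the complementary block in the previous lemma). [folklore] -/
theorem klDiv_map_restrict_le_klDiv_infinitePi (S : Set ι) :
    klDiv (μ.map S.restrict) (Measure.infinitePi fun i : S => ν i) ≤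
      klDiv μ (Measure.infinitePi ν) := by
  classical
  exact le_trans le_self_add (klDiv_map_restrict_add_klDiv_map_restrict_compl_le μ ν (· ∈ S))

/-- **Superadditivity of the relative entropy over two DISJOINT coordinate blocks**:
`KL(μ|_S ‖ ⊗_S ν) + KL(μ|_T ‖ ⊗_T ν) ≤ KL(μ|_{S ∪ T} ‖ ⊗_{S ∪ T} ν)` for disjoint `S, T ⊆ ι` — the previous
complementary-block inequality for the block law `μ|_{S ∪ T}` split along `(· ∈ S)`, the two pieces re-indexed
along the equivalences `{j ∈ S ∪ T | j ∈ S} ≃ S`, `{j ∈ S ∪ T | j ∉ S} ≃ T` (`MeasurableEquiv.piCongrLeft`,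
`Measure.infinitePi_map_piCongrLeft`).  This is the inequality behind the superadditivity of the entropy in
disjoint volumes relative to a product (free) reference state, Georgii § 15.1; Georgii–Zessin 1993 Remark 2.5 (1);
its Poisson-window form is `Literature.MathematicalPhysics.StatisticalMechanics.windowRelEntropy_union_ge`.
[folklore] -/
theorem klDiv_map_restrict_add_klDiv_map_restrict_le_union {S T : Set ι} (hST : Disjoint S T) :
    klDiv (μ.map S.restrict) (Measure.infinitePi fun i : S => ν i) +
        klDiv (μ.map T.restrict) (Measure.infinitePi fun i : T => ν i) ≤
      klDiv (μ.map (S ∪ T).restrict) (Measure.infinitePi fun i : ↥(S ∪ T) => ν i) := by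
  classical
  set μU : Measure (Π i : ↥(S ∪ T), X i) := μ.map (S ∪ T).restrict with hμU
  haveI : IsProbabilityMeasure μU :=
    Measure.isProbabilityMeasure_map (Set.measurable_restrict (S ∪ T)).aemeasurable
  let p : ↥(S ∪ T) → Prop := fun j => (j : ι) ∈ S
  have key := klDiv_map_restrict_add_klDiv_map_restrict_compl_le μU (fun j : ↥(S ∪ T) => ν j) p
  -- re-indexing equivalences of the two blocks
  let eS : {j : ↥(S ∪ T) // p j} ≃ S :=
    ⟨fun j => ⟨j.1.1, j.2⟩, fun i => ⟨⟨i.1, Or.inl i.2⟩, i.2⟩, fun _ => rfl, fun _ => rfl⟩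
  let eT : {j : ↥(S ∪ T) // ¬ p j} ≃ T :=
    ⟨fun j => ⟨j.1.1, j.1.2.resolve_left j.2⟩,
      fun i => ⟨⟨i.1, Or.inr i.2⟩, Set.disjoint_right.1 hST i.2⟩, fun _ => rfl, fun _ => rfl⟩
  let TS := MeasurableEquiv.piCongrLeft (fun i : S => X i) eS
  let TT := MeasurableEquiv.piCongrLeft (fun i : T => X i) eT
  have hS1 : (μ.map S.restrict).map TS.symm = μU.map fun x (j : Subtype p) => x j := by
    rw [Measure.map_map TS.symm.measurable (Set.measurable_restrict S), hμU,
      Measure.map_map (by fun_prop) (Set.measurable_restrict (S ∪ T))]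
    rfl
  have hS2 : (Measure.infinitePi fun i : S => ν i).map TS.symm =
      Measure.infinitePi fun j : Subtype p => ν j := by
    have h := Measure.infinitePi_map_piCongrLeft (fun i : S => ν i) eS
    rw [← h, MeasurableEquiv.map_symm_map]
    rfl
  have hS : klDiv (μ.map S.restrict) (Measure.infinitePi fun i : S => ν i) =
      klDiv (μU.map fun x (j : Subtype p) => x j) (Measure.infinitePi fun j : Subtype p => ν j) := by
    haveI : IsProbabilityMeasure (μ.map S.restrict) :=
      Measure.isProbabilityMeasure_map (Set.measurable_restrict S).aemeasurable
    rw [← hS1, ← hS2]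
    exact (klDiv_map_eq_of_leftInverse TS.symm.measurable TS.measurable TS.apply_symm_apply).symm
  have hT1 : (μ.map T.restrict).map TT.symm = μU.map fun x (j : {j // ¬ p j}) => x j := by
    rw [Measure.map_map TT.symm.measurable (Set.measurable_restrict T), hμU,
      Measure.map_map (by fun_prop) (Set.measurable_restrict (S ∪ T))]
    rfl
  have hT2 : (Measure.infinitePi fun i : T => ν i).map TT.symm =
      Measure.infinitePi fun j : {j // ¬ p j} => ν j := by
    have h := Measure.infinitePi_map_piCongrLeft (fun i : T => ν i) eT
    rw [← h, MeasurableEquiv.map_symm_map]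
    rfl
  have hT : klDiv (μ.map T.restrict) (Measure.infinitePi fun i : T => ν i) =
      klDiv (μU.map fun x (j : {j // ¬ p j}) => x j)
        (Measure.infinitePi fun j : {j // ¬ p j} => ν j) := by
    haveI : IsProbabilityMeasure (μ.map T.restrict) :=
      Measure.isProbabilityMeasure_map (Set.measurable_restrict T).aemeasurable
    rw [← hT1, ← hT2]
    exact (klDiv_map_eq_of_leftInverse TT.symm.measurable TT.measurable TT.apply_symm_apply).symm
  rw [hS, hT]
  exact key

/-! ### § 3 Finite families of disjoint blocks; overlapping families with a disjointness colouring -/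

/-- **Finite superadditivity over pairwise disjoint coordinate blocks**:
`Σ_{b ∈ s} KL(μ|_{S_b} ‖ ⊗_{S_b} ν) ≤ KL(μ|_{⋃_{b ∈ s} S_b} ‖ ⊗_{⋃ S_b} ν)` (induction on `s` with the binary
lemma; the product-coordinate analogue of
`Literature.MathematicalPhysics.StatisticalMechanics.sum_windowRelEntropy_le_biUnion`). [folklore] -/
theorem sum_klDiv_map_restrict_le_biUnion {β : Type*} (s : Finset β) (S : β → Set ι)
    (hd : (s : Set β).PairwiseDisjoint S) :
    ∑ b ∈ s, klDiv (μ.map (S b).restrict) (Measure.infinitePi fun i : S b => ν i) ≤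
      klDiv (μ.map (⋃ b ∈ s, S b).restrict) (Measure.infinitePi fun i : ↥(⋃ b ∈ s, S b) => ν i) := by
  classical
  induction s using Finset.induction_on with
  | empty => simp
  | @insert a s ha ih =>
    have hd' : (s : Set β).PairwiseDisjoint S := hd.subset (by simp)
    have hdisj : Disjoint (S a) (⋃ b ∈ s, S b) := by
      refine Set.disjoint_iUnion₂_right.2 fun b hb => hd (by simp) (by simp [hb]) ?_
      rintro rfl
      exact ha hb
    rw [Finset.sum_insert ha, Finset.set_biUnion_insert]
    calc klDiv (μ.map (S a).restrict) (Measure.infinitePi fun i : S a => ν i) +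
          ∑ b ∈ s, klDiv (μ.map (S b).restrict) (Measure.infinitePi fun i : S b => ν i)
        ≤ klDiv (μ.map (S a).restrict) (Measure.infinitePi fun i : S a => ν i) +
          klDiv (μ.map (⋃ b ∈ s, S b).restrict)
            (Measure.infinitePi fun i : ↥(⋃ b ∈ s, S b) => ν i) := by gcongr; exact ih hd'
      _ ≤ _ := klDiv_map_restrict_add_klDiv_map_restrict_le_union μ ν hdisj

/-- **Sum of block relative entropies over pairwise disjoint blocks is at most the total**:
`Σ_{b ∈ s} KL(μ|_{S_b} ‖ ⊗_{S_b} ν) ≤ KL(μ ‖ ⊗ᵢ νᵢ)` (previous lemma and the coordinate-block data processing). [folklore] -/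
theorem sum_klDiv_map_restrict_le_klDiv_infinitePi {β : Type*} (s : Finset β) (S : β → Set ι)
    (hd : (s : Set β).PairwiseDisjoint S) :
    ∑ b ∈ s, klDiv (μ.map (S b).restrict) (Measure.infinitePi fun i : S b => ν i) ≤
      klDiv μ (Measure.infinitePi ν) :=
  (sum_klDiv_map_restrict_le_biUnion μ ν s S hd).trans (klDiv_map_restrict_le_klDiv_infinitePi μ ν _)

/-- **Overlapping blocks with a disjointness colouring** (the shape the ball cover of AUDIT-4a § 3 item 2 uses,
`C = C_ov`): if the blocks `S_b`, `b ∈ s`, carry colours `c b : Fin C` such that two distinct blocks of the same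
colour are disjoint, then `Σ_{b ∈ s} KL(μ|_{S_b} ‖ ⊗_{S_b} ν) ≤ C · KL(μ ‖ ⊗ᵢ νᵢ)` (sum colour by colour). [folklore] -/
theorem sum_klDiv_map_restrict_le_mul_klDiv_infinitePi {β : Type*} (s : Finset β) (S : β → Set ι)
    {C : ℕ} (c : β → Fin C)
    (hc : ∀ b₁ ∈ s, ∀ b₂ ∈ s, b₁ ≠ b₂ → c b₁ = c b₂ → Disjoint (S b₁) (S b₂)) :
    ∑ b ∈ s, klDiv (μ.map (S b).restrict) (Measure.infinitePi fun i : S b => ν i) ≤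
      C * klDiv μ (Measure.infinitePi ν) := by
  classical
  rw [← Finset.sum_fiberwise s c]
  have hk : ∀ k : Fin C, ∑ b ∈ s with c b = k,
      klDiv (μ.map (S b).restrict) (Measure.infinitePi fun i : S b => ν i) ≤
      klDiv μ (Measure.infinitePi ν) := fun k => by
    refine sum_klDiv_map_restrict_le_klDiv_infinitePi μ ν _ S fun b₁ hb₁ b₂ hb₂ hne => ?_
    simp only [Finset.coe_filter, Set.mem_setOf_eq] at hb₁ hb₂
    exact hc b₁ hb₁.1 b₂ hb₂.1 hne (hb₁.2.trans hb₂.2.symm)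
  calc ∑ k : Fin C, ∑ b ∈ s with c b = k,
        klDiv (μ.map (S b).restrict) (Measure.infinitePi fun i : S b => ν i)
      ≤ ∑ _k : Fin C, klDiv μ (Measure.infinitePi ν) := Finset.sum_le_sum fun k _ => hk k
    _ = C * klDiv μ (Measure.infinitePi ν) := by simp

end Blocks

/-! ### § 4 Single coordinates: `Σ_i KL(μ_i ‖ ν_i) ≤ KL(μ ‖ ⊗ᵢ νᵢ)` -/

section Eval

/-- `Fin n`-indexed form of `sum_klDiv_map_eval_le_klDiv_pi`, by induction on `n`: split off the coordinate `0`
along `MeasurableEquiv.piFinSuccAbove` (`measurePreserving_piFinSuccAbove`), apply the binary superadditivity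
to the image law and the induction hypothesis to its second marginal. [folklore] -/
theorem sum_klDiv_map_eval_le_klDiv_pi_fin : ∀ (n : ℕ) (X : Fin n → Type u)
    [∀ i, MeasurableSpace (X i)] (μ : Measure (Π i, X i)) [IsProbabilityMeasure μ]
    (ν : Π i, Measure (X i)) [∀ i, IsProbabilityMeasure (ν i)],
    ∑ i, klDiv (μ.map (Function.eval i)) (ν i) ≤ klDiv μ (Measure.pi ν)
  | 0, X, _, μ, _, ν, _ => by simp
  | n + 1, X, _, μ, _, ν, _ => by
    set e := MeasurableEquiv.piFinSuccAbove X 0 with he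
    haveI : IsProbabilityMeasure (μ.map e) :=
      Measure.isProbabilityMeasure_map e.measurable.aemeasurable
    set μ' : Measure (Π j : Fin n, X (Fin.succAbove 0 j)) :=
      μ.map fun x j => x (Fin.succAbove 0 j) with hμ'
    haveI : IsProbabilityMeasure μ' :=
      Measure.isProbabilityMeasure_map (Measurable.aemeasurable (by fun_prop))
    have ih := sum_klDiv_map_eval_le_klDiv_pi_fin n (fun j => X (Fin.succAbove 0 j)) μ'
      (fun j => ν (Fin.succAbove 0 j))
    have h1 : (μ.map e).map Prod.fst = μ.map (Function.eval 0) := by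
      rw [Measure.map_map measurable_fst e.measurable]
      rfl
    have h2 : (μ.map e).map Prod.snd = μ' := by
      rw [Measure.map_map measurable_snd e.measurable]
      rfl
    have h3 : klDiv μ (Measure.pi ν) = klDiv (μ.map e) ((Measure.pi ν).map e) :=
      (klDiv_map_eq_of_leftInverse e.measurable e.symm.measurable e.symm_apply_apply).symm
    have h4 : (Measure.pi ν).map e = (ν 0).prod (Measure.pi fun j => ν (Fin.succAbove 0 j)) :=
      (measurePreserving_piFinSuccAbove ν 0).map_eq
    have h5 : ∀ j, μ'.map (Function.eval j) = μ.map (Function.eval (Fin.succAbove 0 j)) := fun j => by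
      rw [hμ', Measure.map_map (measurable_pi_apply j) (by fun_prop)]
      rfl
    rw [Fin.sum_univ_succAbove _ 0, h3, h4, ← h1]
    calc klDiv ((μ.map e).map Prod.fst) (ν 0) +
          ∑ j : Fin n, klDiv (μ.map (Function.eval (Fin.succAbove 0 j))) (ν (Fin.succAbove 0 j))
        = klDiv ((μ.map e).map Prod.fst) (ν 0) +
          ∑ j : Fin n, klDiv (μ'.map (Function.eval j)) (ν (Fin.succAbove 0 j)) := by simp_rw [h5]
      _ ≤ klDiv ((μ.map e).map Prod.fst) (ν 0) +
          klDiv μ' (Measure.pi fun j => ν (Fin.succAbove 0 j)) := by gcongr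
      _ = klDiv ((μ.map e).map Prod.fst) (ν 0) +
          klDiv ((μ.map e).map Prod.snd) (Measure.pi fun j => ν (Fin.succAbove 0 j)) := by rw [h2]
      _ ≤ klDiv (μ.map e) ((ν 0).prod (Measure.pi fun j => ν (Fin.succAbove 0 j))) :=
          klDiv_map_fst_add_klDiv_map_snd_le _ _ _

variable {ι : Type*} [Fintype ι] {X : ι → Type u} [∀ i, MeasurableSpace (X i)]
  (μ : Measure (Π i, X i)) [IsProbabilityMeasure μ] (ν : Π i, Measure (X i))
  [∀ i, IsProbabilityMeasure (ν i)]

/-- **Superadditivity of the relative entropy over independent coordinates** (finite index type): for a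
probability `μ` on `Π i, X i` with one-coordinate marginals `μᵢ = μ ∘ evalᵢ⁻¹` and probabilities `νᵢ`,
`Σᵢ KL(μᵢ ‖ νᵢ) ≤ KL(μ ‖ Measure.pi ν)` (the `Fin n` form re-indexed along `MeasurableEquiv.piCongrLeft`,
`measurePreserving_piCongrLeft`).  Cover–Thomas Thm 2.5.3 / § 2.6; Georgii § 15.1. [folklore] -/
theorem sum_klDiv_map_eval_le_klDiv_pi :
    ∑ i, klDiv (μ.map (Function.eval i)) (ν i) ≤ klDiv μ (Measure.pi ν) := by
  classical
  set f := (Fintype.equivFin ι).symm with hf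
  set e := MeasurableEquiv.piCongrLeft X f with he
  set μ' := μ.map e.symm with hμ'
  haveI : IsProbabilityMeasure μ' := Measure.isProbabilityMeasure_map e.symm.measurable.aemeasurable
  have h1 : klDiv μ (Measure.pi ν) = klDiv μ' (Measure.pi fun k => ν (f k)) := by
    rw [← (measurePreserving_piCongrLeft ν f).map_eq, hμ']
    conv_lhs => rw [← MeasurableEquiv.map_map_symm e (ν := μ)]
    exact klDiv_map_eq_of_leftInverse e.measurable e.symm.measurable e.symm_apply_apply
  have h2 : ∀ k, μ'.map (Function.eval k) = μ.map (Function.eval (f k)) := fun k => by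
    rw [hμ', Measure.map_map (measurable_pi_apply k) e.symm.measurable]
    rfl
  calc ∑ i, klDiv (μ.map (Function.eval i)) (ν i)
      = ∑ k, klDiv (μ.map (Function.eval (f k))) (ν (f k)) :=
        (Equiv.sum_comp f (fun i => klDiv (μ.map (Function.eval i)) (ν i))).symm
    _ = ∑ k, klDiv (μ'.map (Function.eval k)) (ν (f k)) := by simp_rw [h2]
    _ ≤ klDiv μ' (Measure.pi fun k => ν (f k)) :=
        sum_klDiv_map_eval_le_klDiv_pi_fin _ (fun k => X (f k)) μ' (fun k => ν (f k))
    _ = klDiv μ (Measure.pi ν) := h1.symm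

/-- The same with Mathlib's index-general product `Measure.infinitePi` (`= Measure.pi` on a finite index type,
`Measure.infinitePi_eq_pi`): `Σᵢ KL(μᵢ ‖ νᵢ) ≤ KL(μ ‖ ⊗ᵢ νᵢ)`. [folklore] -/
theorem sum_klDiv_map_eval_le_klDiv_infinitePi :
    ∑ i, klDiv (μ.map (Function.eval i)) (ν i) ≤ klDiv μ (Measure.infinitePi ν) := by
  rw [Measure.infinitePi_eq_pi]
  exact sum_klDiv_map_eval_le_klDiv_pi μ ν

end Eval

section EvalFinset

variable {ι : Type*} {X : ι → Type u} [∀ i, MeasurableSpace (X i)]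
  (μ : Measure (Π i, X i)) [IsProbabilityMeasure μ] (ν : Π i, Measure (X i))
  [∀ i, IsProbabilityMeasure (ν i)]

/-- **Finitely many coordinates of an arbitrary product**: for every finite set `s` of coordinates,
`Σ_{i ∈ s} KL(μᵢ ‖ νᵢ) ≤ KL(μ ‖ ⊗ᵢ νᵢ)` (restrict to the block `s`, then the finite-index form). [folklore] -/
theorem finsetSum_klDiv_map_eval_le_klDiv_infinitePi (s : Finset ι) :
    ∑ i ∈ s, klDiv (μ.map (Function.eval i)) (ν i) ≤ klDiv μ (Measure.infinitePi ν) := by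
  set μs : Measure (Π i : (s : Set ι), X i) := μ.map (s : Set ι).restrict with hμs
  haveI : IsProbabilityMeasure μs :=
    Measure.isProbabilityMeasure_map (Set.measurable_restrict (s : Set ι)).aemeasurable
  have hr := klDiv_map_restrict_le_klDiv_infinitePi μ ν (s : Set ι)
  have h := sum_klDiv_map_eval_le_klDiv_infinitePi μs (fun i : (s : Set ι) => ν i)
  have h2 : ∀ i : (s : Set ι), μs.map (Function.eval i) = μ.map (Function.eval (i : ι)) := fun i => by
    rw [hμs, Measure.map_map (measurable_pi_apply i) (Set.measurable_restrict _)]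
    rfl
  rw [← Finset.sum_coe_sort]
  calc ∑ i : s, klDiv (μ.map (Function.eval (i : ι))) (ν i)
      = ∑ i : (s : Set ι), klDiv (μs.map (Function.eval i)) (ν i) := by
        simp_rw [h2]
        rfl
    _ ≤ klDiv μs (Measure.infinitePi fun i : (s : Set ι) => ν i) := h
    _ ≤ klDiv μ (Measure.infinitePi ν) := hr

end EvalFinset

/-! ### § 5 The registered toolkit stub -/

section Registered

/-- **Registered toolkit stub `stub_ballMarginalsProductCore` of crux stmt-AtomisticToContinuum-17740** (serving
stub 4a-i `stub_visibleOneBlockEstimateInBand`; the PRODUCT-REFERENCE core of `ballMarginal_klDiv_sum_le`, AUDIT-4a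
§ 3 item 2): the conjunction of `sum_klDiv_map_eval_le_klDiv_pi` (single coordinates, finite index),
`finsetSum_klDiv_map_eval_le_klDiv_infinitePi` (finitely many coordinates of any product),
`klDiv_map_restrict_add_klDiv_map_restrict_le_union` (two disjoint blocks),
`sum_klDiv_map_restrict_le_klDiv_infinitePi` (finite disjoint families of blocks) and
`sum_klDiv_map_restrict_le_mul_klDiv_infinitePi` (overlapping blocks with a disjointness colouring,
`≤ C · KL`). [folklore] -/
theorem stub_ballMarginalsProductCore : (∀ {ι : Type*} [Fintype ι] {X : ι → Type*} [∀ i, MeasurableSpace (X i)] (μ : MeasureTheory.Measure (Π i, X i)) [MeasureTheory.IsProbabilityMeasure μ] (ν : Π i, MeasureTheory.Measure (X i)) [∀ i, MeasureTheory.IsProbabilityMeasure (ν i)], ∑ i, InformationTheory.klDiv (μ.map (Function.eval i)) (ν i) ≤ InformationTheory.klDiv μ (MeasureTheory.Measure.pi ν)) ∧ (∀ {ι : Type*} {X : ι → Type*} [∀ i, MeasurableSpace (X i)] (μ : MeasureTheory.Measure (Π i, X i)) [MeasureTheory.IsProbabilityMeasure μ] (ν : Π i, MeasureTheory.Measure (X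 i)) [∀ i, MeasureTheory.IsProbabilityMeasure (ν i)] (s : Finset ι), ∑ i ∈ s, InformationTheory.klDiv (μ.map (Function.eval i)) (ν i) ≤ InformationTheory.klDiv μ (MeasureTheory.Measure.infinitePi ν)) ∧ (∀ {ι : Type*} {X : ι → Type*} [∀ i, MeasurableSpace (X i)] (μ : MeasureTheory.Measure (Π i, X i)) [MeasureTheory.IsProbabilityMeasure μ] (ν : Π i, MeasureTheory.Measure (X i)) [∀ i, MeasureTheory.IsProbabilityMeasure (ν i)] {S T : Set ι}, Disjoint S T → InformationTheory.klDiv (μ.map S.restrict) (MeasureTheory.Measure.infinitePi fun i : S => ν i) + InformationTheory.klDiv (μ.map T.restrict) (MeasureTheory.Measure.infinitePi fun i : T => ν i) ≤ InformationTheory.klDiv (μ.map (S ∪ T).restrict) (MeasureTheory.Measure.infinitePi fun i : ↥(S ∪ T) => ν i)) ∧ (∀ {ι : Type*} {X : ι → Type*} [∀ i, MeasurableSpace (X i)] (μ : MeasureTheory.Measure (Π i, X i)) [MeasureTheory.IsProbabilityMeasure μ] (ν : Π i, MeasureTheory.Measure (X i)) [∀ i, MeasureTheory.IsProbabilityMeasure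 (ν i)] {β : Type*} (s : Finset β) (S : β → Set ι), (s : Set β).PairwiseDisjoint S → ∑ b ∈ s, InformationTheory.klDiv (μ.map (S b).restrict) (MeasureTheory.Measure.infinitePi fun i : S b => ν i) ≤ InformationTheory.klDiv μ (MeasureTheory.Measure.infinitePi ν)) ∧ (∀ {ι : Type*} {X : ι → Type*} [∀ i, MeasurableSpace (X i)] (μ : MeasureTheory.Measure (Π i, X i)) [MeasureTheory.IsProbabilityMeasure μ] (ν : Π i, MeasureTheory.Measure (X i)) [∀ i, MeasureTheory.IsProbabilityMeasure (ν i)] {β : Type*} (s : Finset β) (S : β → Set ι) {C : ℕ} (c : β → Fin C), (∀ b₁ ∈ s, ∀ b₂ ∈ s, b₁ ≠ b₂ → c b₁ = c b₂ → Disjoint (S b₁) (S b₂)) → ∑ b ∈ s, InformationTheory.klDiv (μ.map (S b).restrict) (MeasureTheory.Measure.infinitePi fun i : S b => ν i) ≤ C * InformationTheory.klDiv μ (MeasureTheory.Measure.infinitePi ν)) :=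
  ⟨fun μ _ ν _ => sum_klDiv_map_eval_le_klDiv_pi μ ν,
    fun μ _ ν _ s => finsetSum_klDiv_map_eval_le_klDiv_infinitePi μ ν s,
    fun μ _ ν _ _ _ hST => klDiv_map_restrict_add_klDiv_map_restrict_le_union μ ν hST,
    fun μ _ ν _ _ s S hd => sum_klDiv_map_restrict_le_klDiv_infinitePi μ ν s S hd,
    fun μ _ ν _ _ s S _ c hc => sum_klDiv_map_restrict_le_mul_klDiv_infinitePi μ ν s S c hc⟩

end Registered

end Summit.AtomisticToContinuum.HydrodynamicLimit.Theorems.LTEInBand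

end
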